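import Summits.SmoothPoincare4.SmoothPoincare4.Theorems.ConvexBisectionAcyclicBisectionExistsBeltSlideToPushoff
import Summits.SmoothPoincare4.SmoothPoincare4.Theorems.ConvexBisectionAcyclicBisectionExistsBeltPushoffRotation
import Summits.SmoothPoincare4.SmoothPoincare4.Theorems.ConvexBisectionAcyclicBisectionExistsBeltCoreTwisting
import Summits.SmoothPoincare4.SmoothPoincare4.Theorems.ConvexBisectionAcyclicBisectionExistsBeltSlideFramingVector
import HarnessLib

/-!
# Node T3c-1′: the framed belt circles are link-isotopic in `∂X` to the page push-offs of the vanishing cycles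
(node T3c-1′ `node_belt_isotopic_pushoff` of the sub-goal T3 of stub `stub_steinRealisation` (NF6), line
`modp-braid-orbits`, crux `ConvexBisection.AcyclicBisectionExists`, item stmt-SmoothPoincare4-10508;
wave 4, worker Y1, lead c5; THE ASSEMBLY, registered sub-goal `helper_belt_isotopic_pushoff`)

**Node T3c-1′** (the node `node_belt_isotopic_pushoff` of the design file `T3_DualHandles_Design.lean` with V6's
corrected shadow clause `shadow = (l.get j).1 ∨ shadow = -(l.get j).1`): for a Lefschetz link `h` of word `l`
over `Base g`, `X = Base g ∪_{h̄}` (multi-attachment data `D`) and `0 < η`, `η · |l| < π`, the framed belt circles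
of the handles are link-isotopic IN `∂X` to the curves `jA ∘ K j`, `K j` a page curve in the page
`pageDir |l| j · e^{-iη}`, off the cores, of shadow `±(l.get j).1`, with framings `ν j` of page twisting `-t_j`
(`σ₀ = -1`, `t_j = ∓1` the twisting of the letter), the belt framings being carried to `d(jA) (ν j)`.

Assembly, per component `j`: Z4's page tube `Φ_j` around `K_j = (h j).attachingCircle` (`helper_exists_pageTube`);
V6's slide of the belt circle to the `r`-longitude (`slideLinkIsotopy`, `isFramingAlong_slide`,
`attachingCircle_slideMap_one`, `attachingFraming_slideMap_one_eq_mfderiv`); Y1's `exists_slideEnd_to_pushoff`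
(= Z5's tube comparison + Y1's glue (G) + Y2's push-off isotopy; the slide direction `b_j`, the signs `σ_j = t_j`,
`s_j`, the shrink `μ_j` are chosen there), at radius `r_j = r₀/2` and push-off depth
`η'_j = min (1/2) (η / (2 μ_j κ_j))`, so that the push-off lies in the page of angle `-φ₀`, `φ₀ = μ_j κ_j η'_j ∈ (0, η]`;
Y2's riders `shadow_pushoff`, `pageTwisting_pushoff` (bookkeeping of the push-off: shadow `σ_b (l.get j).1`, twisting
`s σ_b = -t_j`); Y1's `exists_pushoffRotation` (rotation to the prescribed page, off the cores, shadow and twisting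
unchanged), pushed through `jA` (`isotopyJA`, `isFramingAlong_jA_push`).  The three isotopies are concatenated
(`KnotIsotopyInBoundary.trans'`, `IsFramingAlong.trans'`) with the same time schedule for all components, so that
the link condition holds phase by phase: during the slide the components sit in the disjoint handles
`range (D.jB j)`, during the tube phases in `jA (range (h j))` (disjoint ranges, `jA` injective), during the rotation
in the pages `pageDir |l| j · e^{-iφ_j(t)}`, `φ_j(t) ∈ (0, η]`, pairwise distinct by the angular separation
`pageDir_rot_ne`.

Everything is proved; no named facts, no `sorry`.

## References
* R. E. Gompf, A. I. Stipsicz, *4-Manifolds and Kirby Calculus* (1999), §8.2 pp. 289–291. [GompfStipsicz1999]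
* A. A. Kosinski, *Differential Manifolds*, Academic Press (1993), VI §6. [Kosinski1993]
-/

noncomputable section

-- the prescribed namespace `Summit.<P>.<Sub>.…` duplicates `SmoothPoincare4` (P = Sub)
set_option linter.dupNamespace false

open scoped Manifold ContDiff Topology
open Set Function Metric Filter

namespace Summit.SmoothPoincare4.SmoothPoincare4.Theorems.AcyclicBisectionExists.ModpBraidOrbits

open Literature.Topology.FourManifolds Literature.Topology.FourManifolds.LefschetzBase
  Literature.Topology.FourManifolds.HandleAttachingMap Literature.Geometry.Symplectic

variable {g : ℕ}

/-! ### §1 Two small tools -/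

/-- Changing the start framing of a framing family along a (propositional) equality. [folklore] -/
theorem isFramingAlong_congr_start {W : Type*} [TopologicalSpace W] [ChartedSpace (EuclideanHalfSpace 4) W]
    [IsManifold (𝓡∂ 4) ∞ W] {K K' : sphere (0 : EuclideanSpace ℝ (Fin 2)) 1 → W} {Φ : KnotIsotopyInBoundary K K'}
    {ν ν' : sphere (0 : EuclideanSpace ℝ (Fin 2)) 1 → EuclideanSpace ℝ (Fin 4)}
    {νt : ℝ → sphere (0 : EuclideanSpace ℝ (Fin 2)) 1 → EuclideanSpace ℝ (Fin 4)}
    (hfr : IsFramingAlong Φ ν νt) (e : ν = ν') : IsFramingAlong Φ ν' νt :=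
  ⟨hfr.apply_zero.trans e, hfr.isKnotFraming, hfr.continuousOn⟩

/-- `s σ_b = -σ` from the winding condition, and the resulting integer page twisting `-t_j`. [folklore] -/
theorem pageTwisting_int_of_real {T : ℤ} {σ s : ℝ} {b bj : Bool} (hσ : σ ^ 2 = 1) (hσj : σ = (if bj then -1 else 1))
    (hb : σ * s * slideSign b = -1) (hT : ((T : ℤ) : ℝ) = s * slideSign b) :
    T = (-1) * (if bj then -1 else 1) := by
  have h1 : s * slideSign b = -σ := by
    have : σ * (s * slideSign b) = -(σ * σ) := by nlinarith [hb, hσ]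
    have hσ0 : σ ≠ 0 := by intro h0; rw [h0] at hσ; norm_num at hσ
    have := mul_left_cancel₀ hσ0 (this.trans (by ring : -(σ * σ) = σ * (-σ)))
    exact this
  have h2 : ((T : ℤ) : ℝ) = (((-1) * (if bj then -1 else 1) : ℤ) : ℝ) := by
    rw [hT, h1, hσj]; push_cast; split_ifs <;> ring
  exact_mod_cast h2

/-! ### §2 The node -/

set_option maxHeartbeats 1600000 in
/-- **Node T3c-1′ `node_belt_isotopic_pushoff`** (see the module docstring). [cite: GompfStipsicz1999, §8.2] -/
theorem exists_belt_isotopic_pushoff (l : List ((Fin g ⊕ Fin g → ℤ) × Bool))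
    (h : Fin l.length → HandleAttachingMap 3 2 (Base g)) (hlink : IsLefschetzLink g l h)
    {X : Type} [TopologicalSpace X] [T2Space X] [ChartedSpace (EuclideanHalfSpace 4) X] [IsManifold (𝓡∂ 4) ∞ X]
    (D : MultiAttachmentData h (𝓡∂ 4) X) (η : ℝ) (hη : 0 < η) (hηπ : η * l.length < Real.pi) :
    ∃ (σ₀ : ℤ) (K : Fin l.length → sphere (0 : EuclideanSpace ℝ (Fin 2)) 1 → Base g)
      (ν : Fin l.length → sphere (0 : EuclideanSpace ℝ (Fin 2)) 1 → EuclideanSpace ℝ (Fin 4))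
      (hKc : ∀ j, Continuous (K j)) (hK : ∀ j θ, K j θ ∈ coresComplement h)
      (Φ : LinkIsotopyInBoundary (fun j => (beltMap D j).attachingCircle)
        (fun j θ => D.jA ⟨K j θ, hK j θ⟩))
      (νt : Fin l.length → ℝ → sphere (0 : EuclideanSpace ℝ (Fin 2)) 1 → EuclideanSpace ℝ (Fin 4)),
      (σ₀ = 1 ∨ σ₀ = -1) ∧
      (∀ (j : Fin l.length) θ,
        K j θ ∈ page g (pageDir l.length j * Complex.exp (-(η : ℂ) * Complex.I))) ∧
      (∀ j, IsBoundaryKnot (K j)) ∧ (∀ j, IsKnotFraming (K j) (ν j)) ∧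
      (∀ j, shadow g (K j) (hKc j) = (l.get j).1 ∨ shadow g (K j) (hKc j) = -(l.get j).1) ∧
      (∀ j, pageTwisting g (K j) (ν j) = σ₀ * (if (l.get j).2 then -1 else 1)) ∧
      (∀ j, IsFramingAlong (Φ.isotopy j) (beltMap D j).attachingFraming (νt j)) ∧
      (∀ j, FramingHomotopic (fun θ => D.jA ⟨K j θ, hK j θ⟩) (νt j 1)
        (fun θ => mfderiv (𝓡∂ 4) (𝓡∂ 4) (fun a : ↥(coresComplement h) => D.jA a)
          ⟨K j θ, hK j θ⟩ (ν j θ))) := by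
  -- Z4's page tubes
  have HZ4 := fun j : Fin l.length => helper_exists_pageTube g (pageDir l.length j) (h j).attachingCircle
    (norm_pageDir _ _) (isSmoothEmbedding_attachingCircle (h j)) (hlink.mem_page j)
  choose κ a R θf Φ hκ ha _hθsm _hθ0 _hθadd hRθ _hθder _hrho hcx hwrot hcore hpages _hfibred hder using HZ4
  -- stages (3a)+(3c)+(3d)
  have H4 := fun j : Fin l.length =>
    exists_slideEnd_to_pushoff g l h hlink D j (κ j) (a j) (Φ j) (hκ j) (ha j) (hcore j) (hder j)
  choose σ s b μ hμ hμ1 r₀ hσj hσ hs hb _hsub hr₀ hr₀4 H4 using H4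
  set r : Fin l.length → ℝ := fun j => r₀ j / 2 with hr_def
  have hr0 : ∀ j, 0 < r j := fun j => by simp only [hr_def]; linarith [hr₀ j]
  have hrr : ∀ j, r j < r₀ j := fun j => by simp only [hr_def]; linarith [hr₀ j]
  have hr2 : ∀ j, r j ≤ 1 / 2 := fun j => by simp only [hr_def]; linarith [hr₀4 j]
  set η' : Fin l.length → ℝ := fun j => min (1 / 2) (η / (2 * (μ j * κ j))) with hη'_def
  have hμκ : ∀ j, 0 < μ j * κ j := fun j => mul_pos (hμ j) (hκ j)
  have hη'0 : ∀ j, 0 < η' j := fun j => lt_min (by norm_num) (div_pos hη (by linarith [hμκ j]))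
  have hη'1 : ∀ j, η' j < 1 := fun j => (min_le_left _ _).trans_lt (by norm_num)
  set φ₀ : Fin l.length → ℝ := fun j => μ j * κ j * η' j with hφ₀_def
  have hφ₀ : ∀ j, 0 < φ₀ j := fun j => mul_pos (hμκ j) (hη'0 j)
  have hφη : ∀ j, φ₀ j ≤ η := fun j => by
    have h1 : η' j ≤ η / (2 * (μ j * κ j)) := min_le_right _ _
    have H : η' j * (2 * (μ j * κ j)) ≤ η := (le_div_iff₀ (by linarith [hμκ j])).1 h1
    have e : μ j * κ j * η' j = (η' j * (2 * (μ j * κ j))) / 2 := by ring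
    show μ j * κ j * η' j ≤ η
    rw [e]; linarith
  have H4' := fun j => H4 j (r j) (η' j) (hr0 j) (hrr j) (hη'0 j) (hη'1 j)
  choose hKend hνend hmem hmem' Ψ₄ νt₄ hst₄ hfr₄ hend₄ using H4'
  -- the push-offs and their pages
  set P : Fin l.length → sphere (0 : EuclideanSpace ℝ (Fin 2)) 1 → Base g := fun j u =>
    ((bBase g).incl ((shrinkTube (Φ j) (hμ j) (hμ1 j)).toHomeo (uDir (b j) u, (-(η' j)) • planeE1)) : Base g) with hP
  have hPpage : ∀ (j : Fin l.length) u, P j u ∈ page g (pageDir l.length j * Complex.exp (-(φ₀ j : ℂ) * Complex.I)) := by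
    intro j u
    have hv : ‖((-(η' j)) • planeE1 : EuclideanSpace ℝ (Fin 2))‖ < 1 := by
      rw [norm_smul, Real.norm_eq_abs, abs_neg, abs_of_pos (hη'0 j)]
      have : ‖(planeE1 : EuclideanSpace ℝ (Fin 2))‖ = 1 := by simp [planeE1]
      rw [this, mul_one]; exact hη'1 j
    have h1 := shrinkTube_mem_page (Φ j) (hμ j) (hμ1 j) (hpages j) (uDir (b j) u) hv
    have e : Complex.exp (Complex.I * ((μ j * κ j : ℝ) : ℂ) * (((-(η' j)) • planeE1 : EuclideanSpace ℝ (Fin 2)) 1 : ℝ)) *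
        pageDir l.length j = pageDir l.length j * Complex.exp (-(φ₀ j : ℂ) * Complex.I) := by
      rw [mul_comm]
      congr 1
      simp only [hφ₀_def, PiLp.smul_apply, planeE1_apply_one, smul_eq_mul, mul_one]
      push_cast
      ring_nf
    rw [e] at h1
    exact h1
  -- the rotation phase
  have H6 := fun j => exists_pushoffRotation hlink j (R j) (hκ j) (hRθ j) (hwrot j) (hcx j) (hφ₀ j) (hφη j) hηπ
    (hPpage j) (hKend j) (hνend j)
  choose Ψ₆ νt₆ hΨ₆ _hνt₆ hcc₆ hpg₆ hfr₆ hfin₆ hsh₆ htw₆ using H6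
  have hK : ∀ (j : Fin l.length) u, (R j).toFun ((φ₀ j - η) / κ j) (P j u) ∈ coresComplement h := fun j u => by
    have h1 := hcc₆ j 1 u
    rwa [hΨ₆, Real.smoothTransition.one, one_mul] at h1
  have hK1 : ∀ (j : Fin l.length) u, (Ψ₆ j).toFun 1 u = (R j).toFun ((φ₀ j - η) / κ j) (P j u) :=
    fun j u => congrFun (Ψ₆ j).map_one u
  -- V6's slide and its junction with the tube phases
  have e₁ : ∀ j : Fin l.length, (slideMap D j (b j) (r j) 1).attachingCircle =
      fun θ => D.jA ⟨(h j).toFun (tubeLongitudePt (b j) (r j) θ), hmem j θ⟩ :=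
    fun j => funext fun θ => attachingCircle_slideMap_one D j (b j) (hr0 j) (hr2 j) θ
  have eν : ∀ j : Fin l.length, (fun t => (slideMap D j (b j) (r j) t).attachingFraming) 1 =
      fun θ => mfderiv (𝓡∂ 4) (𝓡∂ 4) (fun a : ↥(coresComplement h) => D.jA a)
        ⟨(h j).toFun (tubeLongitudePt (b j) (r j) θ), hmem j θ⟩
        (mfderiv (𝓡∂ 4) (𝓡∂ 4) (h j).toFun (tubeLongitudePt (b j) (r j) θ)
          ((closedBallCoeDeriv ((tubeLongitudePt (b j) (r j) θ : ↥(handleTube 3 2)) :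
            closedBall (0 : EuclideanSpace ℝ (Fin 4)) 1)).symm (slideEndVec (b j) (r j) θ))) :=
    fun j => funext fun θ => attachingFraming_slideMap_one_eq_mfderiv D j (b j) (hr0 j) (hr2 j) θ
  -- the per-component isotopies of `∂X`, with their framing families and stage descriptions
  have HT : ∀ j : Fin l.length, ∃ (Tj : KnotIsotopyInBoundary (beltMap D j).attachingCircle
      (fun u => D.jA ⟨(R j).toFun ((φ₀ j - η) / κ j) (P j u), hK j u⟩))
      (νtj : ℝ → sphere (0 : EuclideanSpace ℝ (Fin 2)) 1 → EuclideanSpace ℝ (Fin 4)),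
      IsFramingAlong Tj (beltMap D j).attachingFraming νtj ∧
      (∀ t, t ≤ 1 / 2 → ∀ u, Tj.toFun t u ∈ range (D.jB j)) ∧
      (∀ t, ¬ t ≤ 1 / 2 → KnotIsotopyInBoundary.ρ₂ t ≤ 1 / 2 → ∀ u,
        ∃ x : ↥(coresComplement h), (x : Base g) ∈ range (h j).toFun ∧ Tj.toFun t u = D.jA x) ∧
      (∀ t, ¬ t ≤ 1 / 2 → ¬ KnotIsotopyInBoundary.ρ₂ t ≤ 1 / 2 → ∀ u,
        ∃ φ : ℝ, φ₀ j ≤ φ ∧ φ ≤ η ∧ ∃ x : ↥(coresComplement h),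
          (x : Base g) ∈ page g (pageDir l.length j * Complex.exp (-(φ : ℂ) * Complex.I)) ∧ Tj.toFun t u = D.jA x) ∧
      νtj 1 = fun u => mfderiv (𝓡∂ 4) (𝓡∂ 4) D.jA ⟨(Ψ₆ j).toFun 1 u, hcc₆ j 1 u⟩ (νt₆ j 1 u) := by
    intro j
    have hfr₁ := isFramingAlong_cast (isFramingAlong_slide D j (b j) (r j)) rfl (e₁ j) rfl
    have hfr₃ := isFramingAlong_jA_push D (hcc₆ j) (hfr₆ j)
    have hfr₂₃ := (hfr₄ j).trans' (isFramingAlong_congr_start hfr₃ (funext (hend₄ j)).symm)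
    have hfr := hfr₁.trans' (isFramingAlong_congr_start hfr₂₃ (eν j).symm)
    refine ⟨_, _, hfr, fun t ht u => ?_, fun t ht ht' u => ?_, fun t ht ht' u => ?_, ?_⟩
    · rw [KnotIsotopyInBoundary.trans'_toFun, if_pos ht]
      exact range_slideMap_subset D j (b j) (r j) _ ⟨_, rfl⟩
    · rw [KnotIsotopyInBoundary.trans'_toFun, if_neg ht, KnotIsotopyInBoundary.trans'_toFun, if_pos ht']
      exact hst₄ j _ u
    · rw [KnotIsotopyInBoundary.trans'_toFun, if_neg ht, KnotIsotopyInBoundary.trans'_toFun, if_neg ht']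
      obtain ⟨φ, h1, h2, h3⟩ := hpg₆ j (KnotIsotopyInBoundary.ρ₂ (KnotIsotopyInBoundary.ρ₂ t)) u
      exact ⟨φ, h1, h2, ⟨_, hcc₆ j _ u⟩, h3, rfl⟩
    · show (if (1 : ℝ) ≤ 1 / 2 then _ else (fun t => if t ≤ 1 / 2 then νt₄ j (KnotIsotopyInBoundary.ρ₁ t) else
        (fun t u => mfderiv (𝓡∂ 4) (𝓡∂ 4) D.jA ⟨(Ψ₆ j).toFun t u, hcc₆ j t u⟩ (νt₆ j t u)) (KnotIsotopyInBoundary.ρ₂ t))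
        (KnotIsotopyInBoundary.ρ₂ 1)) = _
      rw [if_neg (by norm_num), KnotIsotopyInBoundary.ρ₂_one]
      show (if (1 : ℝ) ≤ 1 / 2 then νt₄ j (KnotIsotopyInBoundary.ρ₁ 1) else
        (fun t u => mfderiv (𝓡∂ 4) (𝓡∂ 4) D.jA ⟨(Ψ₆ j).toFun t u, hcc₆ j t u⟩ (νt₆ j t u)) (KnotIsotopyInBoundary.ρ₂ 1)) = _
      rw [if_neg (by norm_num), KnotIsotopyInBoundary.ρ₂_one]
  choose T νtT hfrT hstA hstB hstC hendT using HT
  -- continuity of the end knots and of the push-offs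
  have hKc : ∀ j : Fin l.length, Continuous fun u => (R j).toFun ((φ₀ j - η) / κ j) (P j u) :=
    fun j => (Ψ₆ j).isBoundaryKnot_right.isSmoothEmbedding.contMDiff.continuous
  have hPc : ∀ j : Fin l.length, Continuous (P j) := fun j => (hKend j).isSmoothEmbedding.contMDiff.continuous
  have hn : (0 : ℝ) ≤ l.length := by positivity
  refine ⟨-1, fun j u => (R j).toFun ((φ₀ j - η) / κ j) (P j u), fun j => νt₆ j 1, hKc, hK, ⟨T, ?_⟩, νtT,
    Or.inr rfl, hfin₆, fun j => (Ψ₆ j).isBoundaryKnot_right, fun j => (hfr₆ j).isKnotFraming_one,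
    fun j => ?_, fun j => ?_, hfrT, fun j => ?_⟩
  · -- the link condition, phase by phase
    intro t _ i j hij
    rw [Set.disjoint_left]
    rintro _ ⟨u, rfl⟩ ⟨u', hu'⟩
    by_cases ht : t ≤ 1 / 2
    · exact Set.disjoint_left.1 (D.disjointB hij) (hstA i t ht u) (hu' ▸ hstA j t ht u')
    · by_cases ht' : KnotIsotopyInBoundary.ρ₂ t ≤ 1 / 2
      · obtain ⟨x, hx, ex⟩ := hstB i t ht ht' u
        obtain ⟨y, hy, ey⟩ := hstB j t ht ht' u'
        have hxy : x = y := D.hjA.isEmbedding.injective (ex.symm.trans (hu'.symm ▸ ey))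
        exact Set.disjoint_left.1 (hlink.disjoint hij) hx (hxy ▸ hy)
      · obtain ⟨φ, hφ1, hφ2, x, hx, ex⟩ := hstC i t ht ht' u
        obtain ⟨ψ, hψ1, hψ2, y, hy, ey⟩ := hstC j t ht ht' u'
        have hxy : x = y := D.hjA.isEmbedding.injective (ex.symm.trans (hu'.symm ▸ ey))
        have hd : |φ - ψ| < 2 * Real.pi / l.length := by
          have hn' : (0 : ℝ) < l.length := by exact_mod_cast (Nat.zero_le i.1).trans_lt i.2
          have h1 : η < Real.pi / l.length := by rw [lt_div_iff₀ hn']; exact hηπ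
          have h2 : Real.pi / l.length ≤ 2 * Real.pi / l.length := by
            apply div_le_div_of_nonneg_right _ hn'.le; linarith [Real.pi_pos]
          rw [abs_lt]; constructor <;> nlinarith [hφ₀ i, hφ₀ j]
        have hne := pageDir_rot_ne (n := l.length) i.2 j.2 (φ := φ) (ψ := ψ) (Or.inl (Fin.val_ne_of_ne hij)) hd
        exact Set.disjoint_left.1 (disjoint_page g hne) hx (hxy ▸ hy)
  · -- shadow
    have hcore' : ∀ ψ, (bBase g).incl ((shrinkTube (Φ j) (hμ j) (hμ1 j)).core ψ) = (h j).attachingCircle ψ := fun ψ => by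
      rw [shrinkTube_core]; exact hcore j ψ
    have hd : |(-(η' j))| < 1 := by rw [abs_neg, abs_of_pos (hη'0 j)]; exact hη'1 j
    have h1 := hsh₆ j (hPc j) (hKc j)
    have h2 := shadow_pushoff (shrinkTube (Φ j) (hμ j) (hμ1 j)) hcore' (h j).continuous_attachingCircle (b j) hd (hPc j)
    rw [hlink.shadow_eq j] at h2
    rw [h1, h2]
    cases b j
    · left; simp
    · right; simp
  · -- page twisting
    have hcore' : ∀ ψ, (bBase g).incl ((shrinkTube (Φ j) (hμ j) (hμ1 j)).core ψ) = (h j).attachingCircle ψ := fun ψ => by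
      rw [shrinkTube_core]; exact hcore j ψ
    have hd : |(-(η' j))| < 1 := by rw [abs_neg, abs_of_pos (hη'0 j)]; exact hη'1 j
    have h2 := pageTwisting_pushoff (norm_pageDir _ _) (isSmoothEmbedding_attachingCircle (h j)) (hlink.mem_page j)
      (shrinkTube (Φ j) (hμ j) (hμ1 j)) (mul_pos (hμ j) (hκ j)) (mul_pos (hμ j) (ha j)) hcore'
      (fun ψ v hv => shrinkTube_mem_page (Φ j) (hμ j) (hμ1 j) (hpages j) ψ hv)
      (fun t => hasFDerivAt_shrinkTube_fibre' (Φ j) (hμ j) (hμ1 j) (hder j) t) (b j) (hs j) hd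
    rw [htw₆ j]
    exact pageTwisting_int_of_real (hσ j) (hσj j) (hb j) h2
  · -- the end framing is `d(jA) (ν j)` on the nose
    have key : ∀ (G : sphere (0 : EuclideanSpace ℝ (Fin 2)) 1 → Base g) (hG : ∀ u, G u ∈ coresComplement h)
        (_ : G = fun u => (R j).toFun ((φ₀ j - η) / κ j) (P j u)),
        (fun u => mfderiv (𝓡∂ 4) (𝓡∂ 4) D.jA ⟨G u, hG u⟩ (νt₆ j 1 u)) =
          fun u => mfderiv (𝓡∂ 4) (𝓡∂ 4) (fun a : ↥(coresComplement h) => D.jA a)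
            ⟨(R j).toFun ((φ₀ j - η) / κ j) (P j u), hK j u⟩ (νt₆ j 1 u) := by
      intro G hG e; subst e; rfl
    rw [hendT j, key _ (hcc₆ j 1) (funext (hK1 j))]
    exact FramingHomotopic.refl (isBoundaryKnot_jA_comp D (Ψ₆ j).isBoundaryKnot_right (hK j))
      (isKnotFraming_jA_push D (Ψ₆ j).isBoundaryKnot_right (hK j) (hfr₆ j).isKnotFraming_one)

/-! ### §3 Registered helper -/

/-- **Registered helper `helper_belt_isotopic_pushoff` = NODE T3c-1′ `node_belt_isotopic_pushoff` of NF6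
`stub_steinRealisation` (wave 4, lead c5), with V6's corrected shadow clause.**  For a Lefschetz link `h` of word `l`
over `Base g`, `X = Base g ∪_{h̄}` (data `D`) and a small `η > 0` (`η |l| < π`): there are page curves
`K j ⊂ page (pageDir |l| j · e^{-iη})` off all cores, framings `ν j` in `∂ Base g` with page twisting `σ₀ · t_j`
(`σ₀ = -1`), shadow `±(l.get j).1`, and a link isotopy IN `∂X` from the belt circles to `D.jA ∘ K j` carrying the belt
framings to framings homotopic to `d(jA)(ν j)`. [cite: GompfStipsicz1999, §8.2 pp. 289–291] -/
theorem helper_belt_isotopic_pushoff : 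
    ∀ (g : ℕ) (l : List ((Fin g ⊕ Fin g → ℤ) × Bool)) (h : Fin l.length → Literature.Topology.FourManifolds.HandleAttachingMap 3 2 (Literature.Topology.FourManifolds.LefschetzBase.Base g)), Literature.Topology.FourManifolds.LefschetzBase.IsLefschetzLink g l h → ∀ {X : Type} [TopologicalSpace X] [T2Space X] [ChartedSpace (EuclideanHalfSpace 4) X] [IsManifold (𝓡∂ 4) ∞ X] (D : Literature.Topology.FourManifolds.HandleAttachingMap.MultiAttachmentData h (𝓡∂ 4) X) (η : ℝ), 0 < η → η * l.length < Real.pi → ∃ (σ₀ : ℤ) (K : Fin l.length → Metric.sphere (0 : EuclideanSpace ℝ (Fin 2)) 1 → Literature.Topology.FourManifolds.LefschetzBase.Base g) (ν : Fin l.length → Metric.sphere (0 : EuclideanSpace ℝ (Fin 2)) 1 → EuclideanSpace ℝ (Fin 4)) (hKc : ∀ j, Continuous (K j)) (hK : ∀ j θ, K j θ ∈ Literature.Topology.FourManifolds.HandleAttachingMap.coresComplement h) (Φ : Literature.Geometry.Symplectic.LinkIsotopyInBoundary (fun j => (Summit.SmoothPoincare4.SmoothPoincare4.Theorems.AcyclicBisectionExists.ModpBraidOrbits.beltMap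 D j).attachingCircle) (fun j θ => D.jA ⟨K j θ, hK j θ⟩)) (νt : Fin l.length → ℝ → Metric.sphere (0 : EuclideanSpace ℝ (Fin 2)) 1 → EuclideanSpace ℝ (Fin 4)), (σ₀ = 1 ∨ σ₀ = -1) ∧ (∀ (j : Fin l.length) θ, K j θ ∈ Literature.Topology.FourManifolds.LefschetzBase.page g (Literature.Topology.FourManifolds.LefschetzBase.pageDir l.length j * Complex.exp (-(η : ℂ) * Complex.I))) ∧ (∀ j, Literature.Geometry.Symplectic.IsBoundaryKnot (K j)) ∧ (∀ j, Literature.Geometry.Symplectic.IsKnotFraming (K j) (ν j)) ∧ (∀ j, Literature.Topology.FourManifolds.LefschetzBase.shadow g (K j) (hKc j) = (l.get j).1 ∨ Literature.Topology.FourManifolds.LefschetzBase.shadow g (K j) (hKc j) = -(l.get j).1) ∧ (∀ j, Literature.Topology.FourManifolds.LefschetzBase.pageTwisting g (K j) (ν j) = σ₀ * (if (l.get j).2 then -1 else 1)) ∧ (∀ j, Literature.Geometry.Symplectic.IsFramingAlong (Φ.isotopy j) (Summit.SmoothPoincare4.SmoothPoincare4.Theorems.AcyclicBisectionExists.ModpBraidOrbits.beltMap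 D j).attachingFraming (νt j)) ∧ (∀ j, Literature.Geometry.Symplectic.FramingHomotopic (fun θ => D.jA ⟨K j θ, hK j θ⟩) (νt j 1) (fun θ => mfderiv (𝓡∂ 4) (𝓡∂ 4) (fun a : ↥(Literature.Topology.FourManifolds.HandleAttachingMap.coresComplement h) => D.jA a) ⟨K j θ, hK j θ⟩ (ν j θ))) := by
  intro g l h hlink X _ _ _ _ D η hη hηπ
  exact exists_belt_isotopic_pushoff l h hlink D η hη hηπ

end Summit.SmoothPoincare4.SmoothPoincare4.Theorems.AcyclicBisectionExists.ModpBraidOrbits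

end
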